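import Mathlib

/-!
# Flux quadruples per octave (tool stub of line `Sketch`, crux `DyadicWallCascade.HalfSpaceHierarchy`)

Statement (`stub_fluxQuadruplesPerOctave`, item stmt-AnomalousDissipation-18627, card
`octave-transfer-rpf`, first lemma).  Let `V : ℝ³ → ℝ³` be continuous and of degree `0` under the
dilation `X ↦ 2X` on the open half-space `{z > 0}` (`V (2X) = V X` whenever `0 < X 2`).  Then for all
`a, c > 0` the vertical mass flux `∫ V₃` through the dilated square `[0,2a]²` at height `2c` equals
four times the flux through `[0,a]²` at height `c`:
`∫_{[0,2a]²} V₃(x, y, 2c) = 4 ∫_{[0,a]²} V₃(x, y, c)`.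

Proof sketch.  By the dilation hypothesis `V₃(x, y, 2c) = V₃(x/2, y/2, c)`, i.e. the left integrand is
`g (2⁻¹ • q)` with `g p := V₃(p.1, p.2, c)`.  The planar Lebesgue measure on `ℝ × ℝ` is an additive Haar
measure, so the change of variables `q ↦ 2⁻¹ • q` (`Measure.setIntegral_comp_smul_of_pos`) gives
`∫_{s} g (2⁻¹ • q) = ((2⁻¹)²)⁻¹ ∫_{2⁻¹ • s} g = 4 ∫_{[0,a]²} g` for `s = [0,2a]²`, because
`2⁻¹ • ([0,2a] ×ˢ [0,2a]) = [0,a] ×ˢ [0,a]` and `finrank ℝ (ℝ × ℝ) = 2`.  No integrability is needed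
(the Haar change-of-variables formula holds for every function); continuity of `V` is not used.

Source: folklore planar change of variables; card `Ideas/octave-transfer-rpf.md` (§First lemma).
-/

set_option linter.dupNamespace false

noncomputable section

open scoped Pointwise
open MeasureTheory

namespace Summit.AnomalousDissipation.AnomalousDissipation.Theorems.HalfSpaceHierarchy

/-- The dilated square, halved, is the original square:
`2⁻¹ • ([0,2a] ×ˢ [0,2a]) = [0,a] ×ˢ [0,a]` (pointwise scalar action on `ℝ × ℝ`). [folklore] -/
theorem half_smul_dilatedSquare (a : ℝ) :
    (2 : ℝ)⁻¹ • (Set.Icc (0 : ℝ) (2 * a) ×ˢ Set.Icc (0 : ℝ) (2 * a)) =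
      Set.Icc (0 : ℝ) a ×ˢ Set.Icc (0 : ℝ) a := by
  have h2 : (0 : ℝ) < 2⁻¹ := by norm_num
  have ha : (2 : ℝ)⁻¹ * (2 * a) = a := by ring
  rw [Set.smul_set_prod, LinearOrderedField.smul_Icc h2, mul_zero, ha]

/-- Planar change of variables `q ↦ 2⁻¹ • q` on the dilated square: for EVERY `g : ℝ × ℝ → ℝ`,
`∫_{[0,2a]²} g (2⁻¹ • q) dq = 4 ∫_{[0,a]²} g` (Lebesgue measure on `ℝ × ℝ` is an additive Haar measure,
`finrank ℝ (ℝ × ℝ) = 2`, and a non-integrable function has integral `0` on both sides). [folklore] -/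
theorem setIntegral_dilatedSquare_comp_half_smul (g : ℝ × ℝ → ℝ) (a : ℝ) :
    (∫ q in Set.Icc (0 : ℝ) (2 * a) ×ˢ Set.Icc (0 : ℝ) (2 * a), g ((2 : ℝ)⁻¹ • q)) =
      4 * ∫ q in Set.Icc (0 : ℝ) a ×ˢ Set.Icc (0 : ℝ) a, g q := by
  have h2 : (0 : ℝ) < 2⁻¹ := by norm_num
  rw [Measure.setIntegral_comp_smul_of_pos volume g _ h2, half_smul_dilatedSquare,
    Module.finrank_prod, Module.finrank_self, smul_eq_mul]
  norm_num

/-- A point of the plane `z = 2c` is the dilate by `2` of a point of the plane `z = c`: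
`(x, y, 2c) = 2 • (x/2, y/2, c)` in `EuclideanSpace ℝ (Fin 3)`. [folklore] -/
theorem euclid3_eq_two_smul_half (x y c : ℝ) :
    (!₂[x, y, 2 * c] : EuclideanSpace ℝ (Fin 3)) =
      (2 : ℝ) • !₂[(2 : ℝ)⁻¹ * x, (2 : ℝ)⁻¹ * y, c] := by
  ext i
  fin_cases i <;> simp

/-- **Flux quadruples per octave** (card `octave-transfer-rpf`, first lemma).  For a continuous field
`V : ℝ³ → ℝ³` of degree `0` under `X ↦ 2X` on the open half-space `{z > 0}`, the vertical mass flux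
through the dilated square `[0,2a]²` at height `2c` is four times the flux through `[0,a]²` at height
`c` (`a, c > 0`): planar change of variables `q ↦ 2q`.  Continuity is part of the registered signature
but is not needed for the identity (the Haar change-of-variables formula holds for every integrand). -/
theorem stub_fluxQuadruplesPerOctave :
    ∀ (V : EuclideanSpace ℝ (Fin 3) → EuclideanSpace ℝ (Fin 3)), Continuous V →
      (∀ X : EuclideanSpace ℝ (Fin 3), 0 < X 2 → V ((2 : ℝ) • X) = V X) →
      ∀ (a c : ℝ), 0 < a → 0 < c →
        (∫ q in Set.Icc (0 : ℝ) (2 * a) ×ˢ Set.Icc (0 : ℝ) (2 * a),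
            (V !₂[q.1, q.2, 2 * c]) 2)
          = 4 * ∫ q in Set.Icc (0 : ℝ) a ×ˢ Set.Icc (0 : ℝ) a, (V !₂[q.1, q.2, c]) 2 := by
  intro V _ hV a c _ hc
  set g : ℝ × ℝ → ℝ := fun p => (V !₂[p.1, p.2, c]) 2
  have h1 : ∀ q : ℝ × ℝ, (V !₂[q.1, q.2, 2 * c]) 2 = g ((2 : ℝ)⁻¹ • q) := by
    intro q
    have hpos : 0 < (!₂[(2 : ℝ)⁻¹ * q.1, (2 : ℝ)⁻¹ * q.2, c] : EuclideanSpace ℝ (Fin 3)) 2 := by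
      simpa using hc
    rw [euclid3_eq_two_smul_half, hV _ hpos]
    rfl
  simp_rw [h1]
  exact setIntegral_dilatedSquare_comp_half_smul g a

end Summit.AnomalousDissipation.AnomalousDissipation.Theorems.HalfSpaceHierarchy
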